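import Literature.NumberTheory.ModularSymbols.CuspidalHomologyPrymFixedPointSpan
import HarnessLib

/-!
# The push-forward `π_* : H₁(X₀(N), ℤ) → H₁(X₀(N/3), ℤ)` of the triple cover is surjective, and
# `Nm Λ_N = π^* Λ_{N/3}` (`9 ∣ N`)

Topic `Literature/NumberTheory/ModularSymbols`, a leaf over `CuspidalHomologyNormDegeneracy` (the maps
`π_* = pushforwardInt`, `π^* = transferInt`, `Nm = normInt = π^* π_*`, `π_* π^* = 3`) and
`CuspidalHomologyPrymFixedPointSpan` (the lifted symbol `Ψ(g) = {∞, (g∞)/3} ∈ Λ_N` of `g ∈ Γ₀(N/3)`).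
THEOREMS ONLY: no definition, no named fact, no instance, no `sorry`.

`CuspidalHomologyNormDegeneracy` records `3 • π^*Λ_{N/3} ⊆ Nm Λ_N ⊆ π^*Λ_{N/3} ⊆ Λ_B` and flags as NOT
proved there "the surjectivity of `π_*` on `H₁`, from the ramification of `π`".  This file proves it, by
the cusp-lifting argument already used for the Prym defect: for `g = (a b; c d) ∈ Γ₀(N/3)` the lifted
symbol `Ψ(g) = {∞, a/(3c)}_N` (`liftedSymbol`; `gcd(a, 3c) = 1` because `3 ∣ N/3 ∣ c`, and `N ∣ 3c`) is
pushed forward to `{∞, (diag(3,1)·(a/(3c)))}_{N/3} = {∞, a/c}_{N/3} = {∞, g∞}_{N/3}`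
(`pushforwardInt_liftedSymbol`; the tree's `dualMap_degeneracyMap0_periodFunctional`), and the symbols
`{∞, g∞}` exhaust `Λ_{N/3}` (Manin; the tree's `symbolInt_surjective`).  Geometrically: `X₀(N) → X₀(N/3)`
is cyclic of prime degree and totally ramified over the cusp `∞` (the extra generator of
`Γ₀(N/3) = ⟨diag(3,1) Γ₀(N) diag(3,1)⁻¹, T⟩` is the PARABOLIC `T`, whose symbol `{∞, T∞}` vanishes), so
`π_*` is onto on `π₁` and on `H₁` — the homological form of "`f` does not factorize via a cyclic étale
cover", Lange–Rodríguez Prop. 3.2.2 / 3.2.4 (`ker f^*` trivial ⟺ `Ker Nm_f` connected).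

Consequences (all proved): `range pushforwardInt = ⊤`; **`π^* Λ_{N/3} = Nm Λ_N`**
(`range_transferInt_eq_range_normInt`, the `H₁(·, ℤ)`-avatar of Lange–Rodríguez Cor. 3.5.2 (a)
"`Im f^* = {x | x = ∑_σ σ(y)}`"); so the one inclusion still open in the tree, the SATURATION
`Λ_B := ker(t_* − 1) ⊆ π^*Λ_{N/3}` (route `TameQuarticManinParity`, item T31 `ShiftFixedLatticeIsTransfer`,
stmt-BirchSwinnertonDyer-23689 — NOT proved here), is equivalently `Λ_B = Nm Λ_N`, i.e. the vanishing of
the Tate group `Ĥ⁰(⟨t⟩, Λ_N) = Λ_B / Nm Λ_N` (`fixedLattice_le_range_transferInt_iff_le_range_normInt`), and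
equivalently the injectivity of `π^*` modulo `3`: `π^* y ∈ 3Λ_N ⇒ y ∈ 3Λ_{N/3}`
(`fixedLattice_le_range_transferInt_iff_transferInt_three_dvd`; "`ker(π^* : J₀(N/3)[3] → J₀(N)) = 0`").
Nothing about elliptic curves or Galois representations is asserted.  No summit statement is touched.

## References

* H. Lange, R. E. Rodríguez, *Decomposition of Jacobians by Prym Varieties*, LNM 2310 (2022): §3.2.1 and
  Prop. 3.2.2–3.2.4 (PDF p. 55: "`f^*` is not injective iff `f` factorizes via a cyclic étale cover";
  "the number of components of `Ker Nm_f` equals the cardinality of `Ker f^*`"), Prop. 3.5.1 and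
  Cor. 3.5.2 (a) (PDF p. 67: "`Nm_G = f^* ∘ Nm_f`", "`Im f^* = {x | x = ∑_σ σ(y)}`"). [LangeRodriguez2022]
* J. E. Cremona, *Algorithms for modular elliptic curves*, 2nd ed. (1997), §2.1, Lemma 2.1.1
  (`g ↦ {α, gα}` is onto `H₁(X_G, ℤ)`), §2.4 ((2.4.1)–(2.4.2)). [CremonaAlgorithms1997]
* Ju. I. Manin, *Parabolic points and zeta functions of modular curves* (1972), §1.5, Prop. 1.4. [Manin1972]
-/

noncomputable section

open scoped MatrixGroups ModularForm

open CongruenceSubgroup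
open Literature.NumberTheory.EllipticCurves.ModularForms

namespace Literature.NumberTheory.ModularSymbols

/-- `3 ∣ N` when `9 ∣ N` (plumbing). [folklore] -/
private theorem three_dvd_of_nine_dvd' {N : ℕ} (h9 : 3 ^ 2 ∣ N) : 3 ∣ N :=
  (dvd_pow_self 3 two_ne_zero).trans h9

section Pushforward

variable (N : ℕ) [NeZero N] (h9 : 3 ^ 2 ∣ N) (h3 : 3 ∣ N)

/-- **`π_* Ψ(g) = {∞, g∞}_{N/3}`**: the push-forward of the lifted symbol `{∞, (g∞)/3}_N` of
`g = (a b; c d) ∈ Γ₀(N/3)` is the modular symbol of `g` at level `N/3` (`diag(3,1)` sends the cusp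
`a/(3c)` to `a/c = g∞`; Cremona (2.4.1)–(2.4.2) with `M = diag(3,1)`).
[cite: CremonaAlgorithms1997, §2.4 (2.4.1)–(2.4.2)] [cite: DarmonDiamondTaylor1995, Lemma 4.28 (p. 135)] -/
theorem pushforwardInt_liftedSymbol [NeZero (N / 3)] (g : Gamma0 (N / 3)) :
    pushforwardInt N h3 (liftedSymbol N h9 g) = symbolInt (N / 3) g := by
  apply Subtype.ext
  rw [coe_pushforwardInt, liftedSymbol, coe_symbolInt, coe_symbolInt,
    dualMap_degeneracyMap0_periodFunctional (div_three_mul_three_dvd' h9)]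
  have h := symbolInt_eq_of_apply_eq (N / 3)
    (γ := Gamma0.degeneracyConj (N / 3) N 3 (div_three_mul_three_dvd' h9)
      (Gamma0.mkOfCol ((g : SL(2, ℤ)) 0 0) (3 * (g : SL(2, ℤ)) 1 0)
        (isCoprime_apply_three_mul N h9 g) (natCast_dvd_three_mul N h9 g)))
    (γ' := g) (by simp) (by
      simp only [Gamma0.degeneracyConj_apply, Gamma0.degeneracyConjElt_apply_one_zero,
        Gamma0.mkOfCol_apply_one_zero, Nat.cast_ofNat]
      exact Int.mul_ediv_cancel_left _ three_ne_zero)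
  exact congrArg Subtype.val h

include h9 in
/-- **`π_* : H₁(X₀(N), ℤ) → H₁(X₀(N/3), ℤ)` is surjective** (`9 ∣ N`): every `{∞, g∞}_{N/3}` is
`π_* {∞, (g∞)/3}_N`, and these symbols exhaust `H₁(X₀(N/3), ℤ)` (Manin).  The cover
`X₀(N) → X₀(N/3)` is cyclic of degree `3` and totally ramified over `∞`, so it does not factorize via
a cyclic étale cover (Lange–Rodríguez Prop. 3.2.2 / 3.2.4: `Ker Nm_f` is connected).
[cite: LangeRodriguez2022, Prop. 3.2.2 and Prop. 3.2.4 (PDF p. 55) (derived reading: H₁-form, f_* onto)]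
[cite: CremonaAlgorithms1997, §2.1 Lemma 2.1.1] -/
theorem pushforwardInt_surjective [NeZero (N / 3)] : Function.Surjective (pushforwardInt N h3) := by
  intro y
  obtain ⟨g, rfl⟩ := symbolInt_surjective (N / 3) y
  exact ⟨liftedSymbol N h9 g, pushforwardInt_liftedSymbol N h9 h3 g⟩

include h9 in
/-- `π_* Λ_N = Λ_{N/3}`: `range pushforwardInt = ⊤`. [cite: LangeRodriguez2022, Prop. 3.2.2 and Prop. 3.2.4 (PDF p. 55) (derived reading: H₁-form, f_* onto)] -/
theorem range_pushforwardInt_eq_top [NeZero (N / 3)] : LinearMap.range (pushforwardInt N h3) = ⊤ :=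
  LinearMap.range_eq_top.mpr (pushforwardInt_surjective N h9 h3)

end Pushforward

section Transfer

variable (N : ℕ) [NeZero N] (h9 : 3 ^ 2 ∣ N)

/-- **`π^* Λ_{N/3} = Nm Λ_N`** in `Λ_N = H₁(X₀(N), ℤ)` (`9 ∣ N`): `range transferInt = range normInt`.
`⊇` is the tree's `range_normInt_le_range_transferInt` (`Nm = π^* π_*`); `⊆` is `Nm = π^* π_*` with
`π_*` onto.  The `H₁(·, ℤ)`-avatar of Lange–Rodríguez Cor. 3.5.2 (a): "`Im f^* = {x | x = ∑_σ σ(y)}`".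
[cite: LangeRodriguez2022, Cor. 3.5.2 (a) and Prop. 3.5.1 (PDF p. 67) (derived reading: on H₁(·, ℤ), via f_* onto)] -/
theorem range_transferInt_eq_range_normInt [NeZero (N / 3)] :
    LinearMap.range (transferInt N h9) = LinearMap.range (normInt N h9) := by
  refine le_antisymm ?_ (range_normInt_le_range_transferInt N h9)
  rintro _ ⟨y, rfl⟩
  obtain ⟨x, rfl⟩ := pushforwardInt_surjective N h9 (three_dvd_of_nine_dvd' h9) y
  exact ⟨x, (transferInt_pushforwardInt N h9 x).symm⟩

/-- Every transfer is a norm: `π^* y = Nm x` for some `x ∈ Λ_N`. [cite: LangeRodriguez2022, Cor. 3.5.2 (a) (PDF p. 67) (derived reading: on H₁(·, ℤ))] -/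
theorem exists_normInt_eq_transferInt [NeZero (N / 3)] (y : periodHomologyHecke (N / 3)) :
    ∃ x : periodHomologyHecke N, normInt N h9 x = transferInt N h9 y := by
  have h : transferInt N h9 y ∈ LinearMap.range (normInt N h9) := by
    rw [← range_transferInt_eq_range_normInt N h9]
    exact ⟨y, rfl⟩
  obtain ⟨x, hx⟩ := h
  exact ⟨x, hx⟩

/-- `Nm Λ_N` is all of `π^* Λ_{N/3}`: membership form. [cite: LangeRodriguez2022, Cor. 3.5.2 (a) (PDF p. 67) (derived reading: on H₁(·, ℤ))] -/
theorem mem_range_transferInt_iff [NeZero (N / 3)] (x : periodHomologyHecke N) :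
    x ∈ LinearMap.range (transferInt N h9) ↔ ∃ x' : periodHomologyHecke N, normInt N h9 x' = x := by
  rw [range_transferInt_eq_range_normInt N h9]
  exact LinearMap.mem_range

/-! ### What the saturation `Λ_B = π^* Λ_{N/3}` amounts to

The inclusion `Λ_B = ker(t_* − 1) ≤ range transferInt` (item T31 of route `TameQuarticManinParity`) is NOT
proved in the tree; the two proved equivalences below say exactly what it is: the vanishing of
`Ĥ⁰(⟨t⟩, Λ_N) = Λ_B / Nm Λ_N`, equivalently the injectivity of `π^* ⊗ 𝔽₃`. -/

/-- **T31 ⟺ `Λ_B = Nm Λ_N` (`Ĥ⁰(⟨t⟩, H₁(X₀(N), ℤ)) = 0`)**: since `π^*Λ_{N/3} = Nm Λ_N`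
(`range_transferInt_eq_range_normInt`), the saturation `Λ_B ≤ π^*Λ_{N/3}` is the statement that every
`t_*`-fixed integral class is a norm. [cite: LangeRodriguez2022, Cor. 3.5.2 (a) (PDF p. 67) (derived reading: on H₁(·, ℤ))] -/
theorem fixedLattice_le_range_transferInt_iff_le_range_normInt [NeZero (N / 3)] :
    fixedLattice N h9 ≤ LinearMap.range (transferInt N h9) ↔
      fixedLattice N h9 ≤ LinearMap.range (normInt N h9) := by
  rw [range_transferInt_eq_range_normInt N h9]

/-- If `π^* y = 3 • u` then `u` is `t_*`-fixed (`3 • t_* u = t_* π^* y = π^* y = 3 • u` and `Λ_N` is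
torsion-free). [cite: LangeRodriguez2022, §3.2.1 (PDF p. 55) (derived reading: on H₁(·, ℤ))] -/
theorem mem_fixedLattice_of_transferInt_eq_three_smul [NeZero (N / 3)] {y : periodHomologyHecke (N / 3)}
    {u : periodHomologyHecke N} (h : transferInt N h9 y = 3 • u) : u ∈ fixedLattice N h9 := by
  haveI := isAddTorsionFree_periodHomologyHecke N
  rw [mem_fixedLattice_iff]
  have h3 : 3 • shiftInt N h9 u = 3 • u := by
    rw [← map_nsmul, ← h, shiftInt_transferInt]
  exact nsmul_right_injective (by norm_num : (3 : ℕ) ≠ 0) h3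

/-- **T31 ⟺ `π^*` is injective modulo `3`** (`ker(π^* : J₀(N/3)[3] → J₀(N)) = 0`): the saturation
`Λ_B ≤ π^*Λ_{N/3}` holds iff `π^* y ∈ 3Λ_N` forces `y ∈ 3Λ_{N/3}`.  (`⇒`: `π^* y = 3u` makes `u`
`t_*`-fixed, so `u = π^* w` and `y = 3w` by injectivity of `π^*`; `⇐`: for `x ∈ Λ_B`,
`π^*(π_* x) = Nm x = 3x`, so `π_* x = 3w` and `x = π^* w`.)
[cite: LangeRodriguez2022, Prop. 3.2.2–3.2.4 (PDF p. 55) (derived reading: on H₁(·, ℤ) and 3-torsion)] -/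
theorem fixedLattice_le_range_transferInt_iff_transferInt_three_dvd [NeZero (N / 3)] :
    fixedLattice N h9 ≤ LinearMap.range (transferInt N h9) ↔
      ∀ (y : periodHomologyHecke (N / 3)) (u : periodHomologyHecke N),
        transferInt N h9 y = 3 • u → ∃ w : periodHomologyHecke (N / 3), y = 3 • w := by
  haveI := isAddTorsionFree_periodHomologyHecke N
  haveI := isAddTorsionFree_periodHomologyHecke (N / 3)
  constructor
  · intro hle y u h
    obtain ⟨w, hw⟩ := hle (mem_fixedLattice_of_transferInt_eq_three_smul N h9 h)
    refine ⟨w, transferInt_injective N h9 ?_⟩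
    rw [map_nsmul, hw, h]
  · intro H x hx
    have hNm : normInt N h9 x = 3 • x := by
      rw [mem_fixedLattice_iff] at hx
      rw [normInt_apply, hx, hx]
      abel
    have hT : transferInt N h9 (pushforwardInt N (three_dvd_of_nine_dvd' h9) x) = 3 • x := by
      rw [transferInt_pushforwardInt N h9, hNm]
    obtain ⟨w, hw⟩ := H _ _ hT
    refine ⟨w, nsmul_right_injective (by norm_num : (3 : ℕ) ≠ 0) ?_⟩
    change 3 • transferInt N h9 w = 3 • x
    rw [← map_nsmul, ← hw, hT]

end Transfer

end Literature.NumberTheory.ModularSymbols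

end
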